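import Summits.ResolutionOfSingularities.ResolutionOfSingularities.Theorems.ShadowGameWin.Negative.Trap
import Summits.ResolutionOfSingularities.ResolutionOfSingularities.Theorems.ShadowGameWin.Negative.MonoCalc

/-!
# `ShadowGameWin` (crux stmt-ResolutionOfSingularities-16159), negative side — part 5b:
# the period-one trap `a_p` in `k + 2` variables is fixed by EVERY move and is not terminal

`a_p = u v^p − u^(p+1) v^p − u^(p+1) = u (v − uv − u)^p` over `𝔽_p` in the coordinates `u = u_0`,
`v = u_1` of `n = k + 2` variables (the other `k` coordinates are dummies): `SN p k`.  B's policy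
against an announced centre `F`: chart `u` if `u ∈ F`, else `v` if `v ∈ F`, else `min F`
(`chartN`, legal by `chartN_mem`); translate `v` by `1` and every other coordinate by `0` (`tauN`).
EVERY move then fixes `a_p` (`step_SN`): with `u, v ∈ F` (chart `u`) the dummy exponents vanish,
the `F`-order is `p + 1` (division by `u^p`), dummy digits in the translation carry `0^digit = 0`,
and what is left is `(v+1)^p = v^p + 1` in `𝔽_p` with the two new `u`-terms cancelling
(`step_SN_pair`); otherwise neither `u` nor `v` is a translated coordinate, the `F`-order is `< p`
(no division) and blow-up / translation are identities on `a_p` (`step_SN_of_not_pair`).  `a_p` is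
clean (`clean_SN`) and not terminal (`not_terminal_SN`: non-zero, no degree `≤ 1`, the minimal
exponents `(1,p,0,…)`, `(p+1,0,0,…)` are incomparable).  Part 5c (`EveryDim.lean`) turns this into
"B wins `SG_p(n)` for every prime `p` and every `n ≥ 2`; A wins iff `n = 1`".
Monomial calculus: part 5a (`MonoCalc.lean`).
Refuter seat refuter-cdisprove-stmt-ResolutionOfSingularities-16159-0, 2026-08-17.
-/

noncomputable section

set_option linter.dupNamespace false

namespace Summit.ResolutionOfSingularities.ResolutionOfSingularities.Theorems.ShadowGameWin.Negative

section Trap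

/-! ## The trap `a_p = u v^p − u^(p+1) v^p − u^(p+1)` in `k + 2` variables -/

variable (p : ℕ) [hp : Fact p.Prime] (k : ℕ)

/-- The trap series `a_p` embedded in `k + 2` variables (`u = u_0`, `v = u_1`). [folklore] -/
def SN : (Fin (k + 2) → ℕ) → ZMod p :=
  monoN (vec2 1 p) 1 + (monoN (vec2 (p + 1) p) (-1) + (monoN (vec2 (p + 1) 0) (-1) + 0))

/-- Coefficients of `a_p`. [folklore] -/
theorem SN_apply (B : Fin (k + 2) → ℕ) :
    SN p k B = (if B = vec2 1 p then (1 : ZMod p) else 0) +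
      ((if B = vec2 (p + 1) p then (-1 : ZMod p) else 0) +
        ((if B = vec2 (p + 1) 0 then (-1 : ZMod p) else 0) + 0)) := rfl

/-- The support of `a_p`. [folklore] -/
theorem SN_support (B : Fin (k + 2) → ℕ) (h : SN p k B ≠ 0) :
    B = vec2 1 p ∨ B = vec2 (p + 1) p ∨ B = vec2 (p + 1) 0 := by
  rw [SN_apply] at h
  by_contra hc
  simp only [not_or] at hc
  rw [if_neg hc.1, if_neg hc.2.1, if_neg hc.2.2] at h
  simp at h

/-- `a_p` at `(1, p, 0, …)`. [folklore] -/
theorem SN_one_p : SN p k (vec2 1 p) = 1 := by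
  have h1p := hp.out.one_lt
  have h1 : (vec2 1 p : Fin (k + 2) → ℕ) ≠ vec2 (p + 1) p := fun h => by
    have h' := congrFun h 0; rw [vec2_zero, vec2_zero] at h'; omega
  have h2 : (vec2 1 p : Fin (k + 2) → ℕ) ≠ vec2 (p + 1) 0 := fun h => by
    have h' := congrFun h 0; rw [vec2_zero, vec2_zero] at h'; omega
  rw [SN_apply, if_pos rfl, if_neg h1, if_neg h2]; simp

/-- `a_p` at `(p+1, 0, 0, …)`. [folklore] -/
theorem SN_p1_zero : SN p k (vec2 (p + 1) 0) = -1 := by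
  have h1p := hp.out.one_lt
  have h1 : (vec2 (p + 1) 0 : Fin (k + 2) → ℕ) ≠ vec2 1 p := fun h => by
    have h' := congrFun h 1; rw [vec2_one, vec2_one] at h'; omega
  have h2 : (vec2 (p + 1) 0 : Fin (k + 2) → ℕ) ≠ vec2 (p + 1) p := fun h => by
    have h' := congrFun h 1; rw [vec2_one, vec2_one] at h'; omega
  rw [SN_apply, if_neg h1, if_neg h2, if_pos rfl]; simp

/-- `a_p` is clean. [folklore] -/
theorem clean_SN : clean p (SN p k) = SN p k := by
  funext B
  unfold clean
  by_cases h : ∀ j, p ∣ B j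
  · rw [if_pos h]
    by_contra hne
    have h0 := h 0
    have hp1 : ¬ p ∣ 1 := hp.out.one_lt.ne' ∘ Nat.dvd_one.mp
    have hp1' : ¬ p ∣ p + 1 := fun h' => hp1 ((Nat.dvd_add_right (dvd_refl p)).mp h')
    rcases SN_support p k B (Ne.symm hne) with hB | hB | hB <;> rw [hB] at h0
    · exact hp1 h0
    · exact hp1' h0
    · exact hp1' h0
  · rw [if_neg h]

/-- With both `u, v ∈ F` the `F`-order of `a_p` is `p + 1` (division by `u^p`). [folklore] -/
theorem mF_SN_pair (F : Finset (Fin (k + 2))) (h0 : (0 : Fin (k + 2)) ∈ F)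
    (h1 : (1 : Fin (k + 2)) ∈ F) : mF F (SN p k) = p + 1 := by
  refine mF_eq _ _ (p + 1) (vec2 1 p) (by rw [SN_one_p]; exact one_ne_zero)
    (by rw [sum_vec2, if_pos h0, if_pos h1, add_comm]) fun A hA => ?_
  rcases SN_support p k A hA with rfl | rfl | rfl <;> rw [sum_vec2, if_pos h0, if_pos h1] <;> omega

/-- Otherwise the `F`-order of `a_p` is `< p` (no division). [folklore] -/
theorem mF_SN_lt (F : Finset (Fin (k + 2))) (h : ¬ ((0 : Fin (k + 2)) ∈ F ∧ (1 : Fin (k + 2)) ∈ F)) :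
    mF F (SN p k) < p := by
  have h1p := hp.out.one_lt
  by_cases h0 : (0 : Fin (k + 2)) ∈ F
  · have h1 : (1 : Fin (k + 2)) ∉ F := fun h1 => h ⟨h0, h1⟩
    exact mF_lt _ _ (vec2 1 p) (by rw [SN_one_p]; exact one_ne_zero) p
      (by rw [sum_vec2, if_pos h0, if_neg h1]; omega)
  · refine mF_lt _ _ (vec2 (p + 1) 0) (by rw [SN_p1_zero]; exact neg_ne_zero.mpr one_ne_zero) p ?_
    rw [sum_vec2, if_neg h0]; split_ifs <;> omega

/-! ## B's policy; every move fixes `a_p` -/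

/-- B's chart: `u` if allowed, else `v` if allowed, else the least allowed coordinate.
[folklore] -/
def chartN (F : Finset (Fin (k + 2))) : Fin (k + 2) :=
  if (0 : Fin (k + 2)) ∈ F then 0 else if (1 : Fin (k + 2)) ∈ F then 1 else
    if h : F.Nonempty then F.min' h else 0

/-- B's translation: `v ↦ v + 1`, every other coordinate by `0`. [folklore] -/
def tauN : Fin (k + 2) → ZMod p := fun j => if j = 1 then 1 else 0

omit hp in
/-- B's chart is legal. [folklore] -/
theorem chartN_mem (F : Finset (Fin (k + 2))) (hF : F.Nonempty) : chartN k F ∈ F := by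
  unfold chartN
  split_ifs with h0 h1
  · exact h0
  · exact h1
  · exact Finset.min'_mem F hF

/-- Binomial coefficients `C(p, l)` vanish in `𝔽_p` for `0 < l < p`. [folklore] -/
theorem choose_cast_eq_zeroN (l : ℕ) (h0 : l ≠ 0) (hl : l < p) :
    ((Nat.choose p l : ℕ) : ZMod p) = 0 := by
  rw [ZMod.natCast_eq_zero_iff]
  exact hp.out.dvd_choose_self h0 hl

/-- A centre NOT containing both `u` and `v` is the identity on `a_p` (orders `< p`, no
division; the translated coordinates are translated by `0`). [folklore] -/
theorem step_SN_of_not_pair (F : Finset (Fin (k + 2)))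
    (h : ¬ ((0 : Fin (k + 2)) ∈ F ∧ (1 : Fin (k + 2)) ∈ F)) :
    step p F (chartN k F) (tauN p k) (SN p k) = SN p k := by
  -- neither `u` nor `v` is a translated coordinate
  have h0e : (0 : Fin (k + 2)) ∉ F.erase (chartN k F) := by
    intro hm
    have h0F := (Finset.mem_erase.mp hm)
    apply h0F.1
    unfold chartN; rw [if_pos h0F.2]
  have h1e : (1 : Fin (k + 2)) ∉ F.erase (chartN k F) := by
    intro hm
    have h1F := (Finset.mem_erase.mp hm)
    apply h1F.1
    unfold chartN
    by_cases h0 : (0 : Fin (k + 2)) ∈ F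
    · exact absurd ⟨h0, h1F.2⟩ h
    · rw [if_neg h0, if_pos h1F.2]
  have hsum : ∀ a b : ℕ,
      Finset.sum (F.erase (chartN k F)) (fun j => (vec2 a b : Fin (k + 2) → ℕ) j) = 0 := by
    intro a b; rw [sum_vec2, if_neg h0e, if_neg h1e]
  have hτ : ∀ j ∈ F.erase (chartN k F), tauN p k j = 0 := by
    intro j hj
    unfold tauN
    rw [if_neg]
    rintro rfl
    exact h1e hj
  unfold step
  rw [clean_SN, Nat.div_eq_of_lt (mF_SN_lt p k F h), mul_zero, dv_zero', tr_eq_self_of_tau_zero _ _ _ hτ]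
  unfold SN
  rw [bl_add, bl_add, bl_add, bl_zero, bl_monoN, bl_monoN, bl_monoN, hsum, hsum, hsum,
    update_add_zero_self, update_add_zero_self, update_add_zero_self]
  exact clean_SN p k

/-- THE FIXED POINT in `k + 2` variables: a centre containing `u` and `v`, chart `u`, division by
`u^p`, translation `v ↦ v + 1` (others by `0`) and cleaning return `a_p`. [folklore] -/
theorem step_SN_pair (F : Finset (Fin (k + 2))) (h0 : (0 : Fin (k + 2)) ∈ F)
    (h1 : (1 : Fin (k + 2)) ∈ F) : step p F 0 (tauN p k) (SN p k) = SN p k := by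
  have h1p : 1 < p := hp.out.one_lt
  have hdiv : p * ((p + 1) / p) = p := by
    rw [Nat.div_eq_of_lt_le (k := 1) (by omega) (by omega), mul_one]
  have h1e : (1 : Fin (k + 2)) ∈ F.erase 0 := Finset.mem_erase.mpr ⟨by simp, h1⟩
  have h0e : (0 : Fin (k + 2)) ∉ F.erase 0 := fun hm => (Finset.mem_erase.mp hm).1 rfl
  have hsum : ∀ a b : ℕ,
      Finset.sum (F.erase 0) (fun j => (vec2 a b : Fin (k + 2) → ℕ) j) = b := by
    intro a b; rw [sum_vec2, if_neg h0e, if_pos h1e, zero_add]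
  have hτ1 : tauN p k 1 = 1 := if_pos rfl
  have hτ : ∀ j ∈ F.erase 0, j ≠ 1 → tauN p k j = 0 := fun j _ hj => if_neg hj
  unfold step
  rw [clean_SN, mF_SN_pair p k F h0 h1, hdiv]
  unfold SN
  rw [bl_add, bl_add, bl_add, bl_zero, bl_monoN, bl_monoN, bl_monoN, hsum, hsum, hsum,
    vec2_zero, vec2_zero, vec2_zero, update_vec2_zero, update_vec2_zero, update_vec2_zero]
  rw [dv_add, dv_add, dv_add, show dv 0 p (0 : (Fin (k + 2) → ℕ) → ZMod p) = 0 from rfl,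
    dv_monoN 0 p _ _ (by show p ≤ 1 + p; omega), dv_monoN 0 p _ _ (by show p ≤ p + 1 + p; omega),
    dv_monoN 0 p _ _ (by show p ≤ p + 1 + 0; omega), vec2_zero, vec2_zero, vec2_zero,
    update_vec2_zero, update_vec2_zero, update_vec2_zero,
    show 1 + p - p = 1 by omega, show p + 1 + p - p = p + 1 by omega,
    show p + 1 + 0 - p = 1 by omega]
  rw [tr_add, tr_add, tr_add, tr_zero,
    tr_monoN F h1 _ hτ1 hτ p (vec2 1 p) 1 (by rw [vec2_one, vec2_zero]; omega),
    tr_monoN F h1 _ hτ1 hτ p (vec2 (p + 1) p) (-1) (by rw [vec2_one, vec2_zero]; omega),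
    tr_monoN F h1 _ hτ1 hτ p (vec2 1 0) (-1) (by rw [vec2_one, vec2_zero]; omega)]
  -- cleaning, and the comparison coefficient by coefficient
  funext B
  have e1 : ∀ a b : ℕ, (∀ j : Fin (k + 2), j ≠ 1 → B j = (vec2 a b : Fin (k + 2) → ℕ) j) =
      (B 0 = a ∧ ∀ j : Fin (k + 2), 2 ≤ j.val → B j = 0) :=
    fun a b => propext (forall_ne_one_iff B a b)
  have e2 : ∀ a b : ℕ, (B = vec2 a b) = (B 0 = a ∧ B 1 = b ∧ ∀ j : Fin (k + 2), 2 ≤ j.val → B j = 0) :=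
    fun a b => propext (eq_vec2_iff B a b)
  unfold clean monoN
  simp only [Pi.add_apply, add_zero, one_mul, Nat.le_zero, vec2_one, e1, e2]
  by_cases hD : ∀ j : Fin (k + 2), 2 ≤ j.val → B j = 0
  · have hmask : (∀ j, p ∣ B j) ↔ p ∣ B 0 ∧ p ∣ B 1 := by
      constructor
      · exact fun h => ⟨h 0, h 1⟩
      · rintro ⟨h0', h1'⟩ j
        by_cases hj0 : j = 0
        · subst hj0; exact h0'
        · by_cases hj1 : j = 1
          · subst hj1; exact h1'
          · rw [hD j ((two_le_val_iff j).mpr ⟨hj0, hj1⟩)]; exact dvd_zero p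
    simp only [iff_true_intro hD, hmask, and_true]
    generalize B 0 = b0, B 1 = b1
    have hp0 : p ≠ 0 := by omega
    by_cases hb0 : b0 = 1
    · subst hb0
      have hrow : ¬ (p ∣ 1 ∧ p ∣ b1) := fun h => absurd (Nat.le_of_dvd one_pos h.1) (by omega)
      rw [if_neg hrow, if_neg (fun h : 1 = p + 1 ∧ b1 ≤ p => by omega),
        if_neg (fun h : 1 = p + 1 ∧ b1 = p => by omega),
        if_neg (fun h : 1 = p + 1 ∧ b1 = 0 => by omega), zero_add, zero_add, add_zero]
      rcases Nat.lt_trichotomy b1 p with hlt | heq | hgt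
      · rw [if_pos ⟨rfl, hlt.le⟩, if_neg (fun h : 1 = 1 ∧ b1 = p => hlt.ne h.2)]
        by_cases hz : b1 = 0
        · subst hz
          rw [if_pos ⟨rfl, rfl⟩, Nat.choose_zero_right, Nat.choose_zero_right]; simp
        · rw [if_neg (fun h : 1 = 1 ∧ b1 = 0 => hz h.2), choose_cast_eq_zeroN p b1 hz hlt]; simp
      · rw [if_pos ⟨rfl, heq.le⟩, if_neg (fun h : 1 = 1 ∧ b1 = 0 => hp0 (heq.symm.trans h.2)),
          if_pos ⟨rfl, heq⟩, heq, Nat.choose_self]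
        simp
      · rw [if_neg (fun h : 1 = 1 ∧ b1 ≤ p => by omega), if_neg (fun h : 1 = 1 ∧ b1 = 0 => by omega),
          if_neg (fun h : 1 = 1 ∧ b1 = p => by omega)]
        simp
    · by_cases hb1 : b0 = p + 1
      · subst hb1
        have hrow : ¬ (p ∣ p + 1 ∧ p ∣ b1) := fun h =>
          absurd (Nat.le_of_dvd one_pos ((Nat.dvd_add_right (dvd_refl p)).mp h.1)) (by omega)
        rw [if_neg hrow, if_neg (fun h : p + 1 = 1 ∧ b1 ≤ p => hb0 h.1),
          if_neg (fun h : p + 1 = 1 ∧ b1 = 0 => hb0 h.1),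
          if_neg (fun h : p + 1 = 1 ∧ b1 = p => hb0 h.1), zero_add, add_zero, zero_add]
        rcases Nat.lt_trichotomy b1 p with hlt | heq | hgt
        · rw [if_pos ⟨rfl, hlt.le⟩, if_neg (fun h : p + 1 = p + 1 ∧ b1 = p => hlt.ne h.2)]
          by_cases hz : b1 = 0
          · subst hz
            rw [if_pos ⟨rfl, rfl⟩, Nat.choose_zero_right]; simp
          · rw [if_neg (fun h : p + 1 = p + 1 ∧ b1 = 0 => hz h.2),
              choose_cast_eq_zeroN p b1 hz hlt]
            simp
        · rw [if_pos ⟨rfl, heq.le⟩, if_pos ⟨rfl, heq⟩,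
            if_neg (fun h : p + 1 = p + 1 ∧ b1 = 0 => hp0 (heq.symm.trans h.2)), heq,
            Nat.choose_self]
          simp
        · rw [if_neg (fun h : p + 1 = p + 1 ∧ b1 ≤ p => by omega),
            if_neg (fun h : p + 1 = p + 1 ∧ b1 = p => by omega),
            if_neg (fun h : p + 1 = p + 1 ∧ b1 = 0 => by omega)]
          simp
      · rw [if_neg (fun h : b0 = 1 ∧ b1 ≤ p => hb0 h.1), if_neg (fun h : b0 = p + 1 ∧ b1 ≤ p => hb1 h.1),
          if_neg (fun h : b0 = 1 ∧ b1 = 0 => hb0 h.1), if_neg (fun h : b0 = 1 ∧ b1 = p => hb0 h.1),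
          if_neg (fun h : b0 = p + 1 ∧ b1 = p => hb1 h.1),
          if_neg (fun h : b0 = p + 1 ∧ b1 = 0 => hb1 h.1)]
        simp
  · -- exponents with a non-zero dummy coordinate: everything vanishes
    simp only [eq_false hD, and_false, false_and, if_false, add_zero]
    split_ifs <;> rfl

/-- THE TRAP (period one) in `k + 2` variables: whatever non-empty centre A announces, B's
answer fixes `a_p`. [folklore] -/
theorem step_SN (F : Finset (Fin (k + 2))) :
    step p F (chartN k F) (tauN p k) (SN p k) = SN p k := by
  by_cases h : (0 : Fin (k + 2)) ∈ F ∧ (1 : Fin (k + 2)) ∈ F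
  · rw [show chartN k F = 0 by unfold chartN; rw [if_pos h.1]]
    exact step_SN_pair p k F h.1 h.2
  · exact step_SN_of_not_pair p k F h

/-- `a_p` is not terminal: clean, non-zero, no monomial of degree `≤ 1`, and the minimal
exponents `(1, p, 0…)`, `(p+1, 0, 0…)` are incomparable. [folklore] -/
theorem not_terminal_SN :
    ¬ ((∀ A, clean p (SN p k) A = 0) ∨ ∃ A, clean p (SN p k) A ≠ 0 ∧
        (Finset.sum Finset.univ (fun j => A j) ≤ 1 ∨
          ∀ B, clean p (SN p k) B ≠ 0 → ∀ j, A j ≤ B j)) := by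
  have h1p : 1 < p := hp.out.one_lt
  rw [clean_SN]
  rintro (h0 | ⟨A, hA, hT⟩)
  · exact absurd (h0 (vec2 1 p)) (by rw [SN_one_p]; exact one_ne_zero)
  · rcases hT with hT | hT
    · rcases SN_support p k A hA with rfl | rfl | rfl <;>
        rw [sum_vec2, if_pos (Finset.mem_univ _), if_pos (Finset.mem_univ _)] at hT <;> omega
    · have hx := hT (vec2 1 p) (by rw [SN_one_p]; exact one_ne_zero) 0
      have hy := hT (vec2 (p + 1) 0) (by rw [SN_p1_zero]; exact neg_ne_zero.mpr one_ne_zero) 1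
      rw [vec2_zero] at hx
      rw [vec2_one] at hy
      rcases SN_support p k A hA with rfl | rfl | rfl
      · rw [vec2_one] at hy; omega
      · rw [vec2_zero] at hx; omega
      · rw [vec2_zero] at hx; omega

end Trap

end Summit.ResolutionOfSingularities.ResolutionOfSingularities.Theorems.ShadowGameWin.Negative

end
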